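import Summits.BirchSwinnertonDyer.BirchSwinnertonDyer.Theses.KatoDescentPotSupersingular
import Summits.BirchSwinnertonDyer.BirchSwinnertonDyer.Theorems.KatoDescentPotSupersingularZetaLineRankZero
import HarnessLib

/-!
# Crux M of route `KatoDescentPotSupersingular` (K9) BY NAME from TWO held inputs — modularity and Kato's CORE member package —
# with NO Gross–Zagier–Kolyvagin and NO Poitou–Tate binder: typed closers over the live aliases
# (crux M = stmt-BirchSwinnertonDyer-19196 `ReducibleKatoMember`; `--supports`, closes nothing)

Seat `bsd-potss-rkm` g25 (prover; cell `bsd-potss`).  HONEST FRAMING: BSD is not proved by any of this; nothing is booked; the held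
input `Kato2004.exists_memberHullZetaCoreInputs` (child 27962; Kato's Euler system + explicit reciprocity at the member, size XL) is
unchanged and un-discharged.  What is new (route-free theorem `ZetaLineRankZero.katoMemberShaBoundOfReducible_of_newform_of_coreInputs`,
this seat): the finiteness of `W_K(ℚ)` that the level-`0` ledger needs is a CONSEQUENCE of clause (b′) of the core package (Kato Cor. 14.3 /
Thm. 14.5, reciprocity + the log lattice), so the GZK half of the bundle child 28002 `PublishedInputsModularityGZK` and the (closed)
Poitou–Tate child 27963 are IDLE for M: the live 4-ary glue 28004 `ReducibleKatoMemberOfCoreInputs` is implied by the 2-ary theorems below.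

* `wildReducibleKatoMember_of_modularityU0Red_of_coreInputs : PublishedInputModularityU0Red → PublishedInputMemberHullZetaCore → ReducibleKatoMember`
  (U₀-red's live modularity alias, gen 3, + M's core child 27962);
* `reducibleKatoMemberOfCoreInputs_of_modularity_gzkIdle` — the live 4-ary glue shape with the bundle 28002 used through `.1` and binders 3–4 unused;
* `wildReducibleKatoMember_of_newform_of_coreInputs` — the Literature-constant form `exists_isNewformOf → exists_memberHullZetaCoreInputs → …`.

References: K. Kato, Astérisque 295 (2004), Cor. 14.3, Thm. 14.5 (pp. 235–236), Prop. 14.16 (2) (pp. 244–245) [Kato2004Asterisque];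
C. Breuil, B. Conrad, F. Diamond, R. Taylor, J. Amer. Math. Soc. 14 (2001) [BreuilConradDiamondTaylor2001].
-/

-- the summit and its single problem are both named `BirchSwinnertonDyer` (registry layout D-0017)
set_option linter.dupNamespace false
set_option autoImplicit false

noncomputable section

open Literature.NumberTheory.EllipticCurves Literature.NumberTheory.EllipticCurves.ModularForms
  Literature.NumberTheory.EllipticCurves.Kato2004
open Summit.BirchSwinnertonDyer.BirchSwinnertonDyer.Theorems

namespace Summit.BirchSwinnertonDyer.BirchSwinnertonDyer.Theorems.CoreInputsNoGZK

/-- **Crux M (K9) from modularity and the core package, Literature-constant form** — no GZK, no Poitou–Tate binder.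
[cite: Kato2004Asterisque, Cor. 14.3, Thm. 14.5 (pp. 235–236), Prop. 14.16 (2) (pp. 244–245)] -/
theorem wildReducibleKatoMember_of_newform_of_coreInputs (hmod : exists_isNewformOf) (hC : exists_memberHullZetaCoreInputs) :
    Summit.BirchSwinnertonDyer.BirchSwinnertonDyer.Theses.KatoDescentPotSupersingular.ReducibleKatoMember :=
  ZetaLineRankZero.katoMemberShaBoundOfReducible_of_newform_of_coreInputs hmod hC

/-- **Crux M (K9) BY NAME from the live aliases `PublishedInputModularityU0Red` (modularity, U₀-red gen 4) and `PublishedInputMemberHullZetaCore` (27962).**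
[cite: Kato2004Asterisque, Cor. 14.3, Thm. 14.5 (pp. 235–236), Prop. 14.16 (2) (pp. 244–245)] [cite: BreuilConradDiamondTaylor2001, Thm. A] -/
theorem wildReducibleKatoMember_of_modularityU0Red_of_coreInputs :
    Summit.BirchSwinnertonDyer.BirchSwinnertonDyer.Theses.KatoDescentPotSupersingular.PublishedInputModularityU0Red →
    Summit.BirchSwinnertonDyer.BirchSwinnertonDyer.Theses.KatoDescentPotSupersingular.PublishedInputMemberHullZetaCore →
    Summit.BirchSwinnertonDyer.BirchSwinnertonDyer.Theses.KatoDescentPotSupersingular.ReducibleKatoMember :=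
  fun hmod hC => wildReducibleKatoMember_of_newform_of_coreInputs hmod hC

/-- **The live glue 28004 `ReducibleKatoMemberOfCoreInputs` with its GZK half and its Poitou–Tate and display-only binders IDLE**: the bundle
`PublishedInputsModularityGZK` is used through its modularity conjunct only. [cite: Kato2004Asterisque, Cor. 14.3, Thm. 14.5 (pp. 235–236)] -/
theorem reducibleKatoMemberOfCoreInputs_of_modularity_gzkIdle :
    Summit.BirchSwinnertonDyer.BirchSwinnertonDyer.Theses.KatoDescentPotSupersingular.PublishedInputsModularityGZK →
    Summit.BirchSwinnertonDyer.BirchSwinnertonDyer.Theses.KatoDescentPotSupersingular.PublishedInputMemberHullZetaCore →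
    Summit.BirchSwinnertonDyer.BirchSwinnertonDyer.Theses.KatoDescentPotSupersingular.HeldPoitouTateSelmerDualityQ →
    Summit.BirchSwinnertonDyer.BirchSwinnertonDyer.Theses.KatoDescentPotSupersingular.PublishedInputMemberHullZetaInputsNamed →
    Summit.BirchSwinnertonDyer.BirchSwinnertonDyer.Theses.KatoDescentPotSupersingular.ReducibleKatoMember :=
  fun hMG hC _ _ => wildReducibleKatoMember_of_newform_of_coreInputs hMG.1 hC

end Summit.BirchSwinnertonDyer.BirchSwinnertonDyer.Theorems.CoreInputsNoGZK

end
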